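import Summits.QuantumFields.YangMills.Theorems.EquipartitionCriticalityEquipartitionPinsProbeRigidityB
import HarnessLib

/-!
# Rigidity of the lattice Maxwell field under the equipartition budget — part C (line defect identity)

Route `EquipartitionCriticality` of `YangMills`, crux item `stmt-QuantumFields-8760`
(`EquipartitionPinsProbe`), line `Sketch`, STUB R (`stub_rigidity`) of the lead prover: every
probability measure `τ` on `ℝ^D`-valued 2-cochains `Y : ZdPlaquette 4 → Fin D → ℝ` of `ℤ⁴` that is
a.s. closed, has uniformly bounded second moments with the equipartition budget, and satisfies the
(trigonometric) Stein identity of the lattice Maxwell field IS `curvatureGaussianField 4 D`.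

This file: the LINE DEFECT IDENTITY — for the indicator `δ` of `((0;i,j),a)` and the axial line
averages `h_L` in the same plane and colour (same plane–colour sums), the factorization (F5) and
the moment lemma (F6) give `E(Y^a_{(0;i,j)})² − ½ = E⟨Y,h_L⟩² − Q(h_L)`.
-/

noncomputable section

open MeasureTheory Filter Topology
open scoped BigOperators
open Literature.MathematicalPhysics.QuantumFieldTheory Literature.MathematicalPhysics.QuantumLattice
open Literature.Probability.LatticeModels

namespace Summit.QuantumFields.YangMills.Theorems.EquipartitionPinsProbe

namespace Rigidity

section Main

variable {D : ℕ} {τ : Measure (ZdPlaquette 4 → Fin D → ℝ)}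

/-- **Line defect identity.** For the indicator `δ` of `((0;i,j), a)` and the line averages
`h_L` (length `L+1`) in the same plane and colour — which have the same plane–colour sums — the
factorization (F5) and the moment lemma (F6) give
`E(Y^a_{(0;i,j)})² − ½ = E(L⁻¹∑_{t<L} Y^a_{(te₀;i,j)})² − Q(h_L)`. -/
theorem line_defect
    (hF5τ : ∀ (S : Finset (ZdPlaquette 4)) (h h' : ZdPlaquette 4 → Fin D → ℝ),
      (∀ (i j : Fin 4) (hij : i < j) (a : Fin D),
        ∑ p ∈ S, (if p.2 = ⟨(i, j), hij⟩ then h p a else 0) =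
          ∑ p ∈ S, (if p.2 = ⟨(i, j), hij⟩ then h' p a else 0)) →
      (Real.exp ((∑ p ∈ S, ∑ q ∈ S, ∑ a : Fin D,
            h p a * h q a * curvatureTwoPoint p q) / 2) *
          ∫ Y, Real.cos (∑ p ∈ S, ∑ a : Fin D, h p a * Y p a) ∂τ =
        Real.exp ((∑ p ∈ S, ∑ q ∈ S, ∑ a : Fin D,
            h' p a * h' q a * curvatureTwoPoint p q) / 2) *
          ∫ Y, Real.cos (∑ p ∈ S, ∑ a : Fin D, h' p a * Y p a) ∂τ) ∧
      (Real.exp ((∑ p ∈ S, ∑ q ∈ S, ∑ a : Fin D,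
            h p a * h q a * curvatureTwoPoint p q) / 2) *
          ∫ Y, Real.sin (∑ p ∈ S, ∑ a : Fin D, h p a * Y p a) ∂τ =
        Real.exp ((∑ p ∈ S, ∑ q ∈ S, ∑ a : Fin D,
            h' p a * h' q a * curvatureTwoPoint p q) / 2) *
          ∫ Y, Real.sin (∑ p ∈ S, ∑ a : Fin D, h' p a * Y p a) ∂τ))
    (hF6τ : ∀ (S : Finset (ZdPlaquette 4)) (h : ZdPlaquette 4 → Fin D → ℝ),
      Tendsto (fun s : ℝ =>
          (1 - ∫ Y, Real.cos (s * ∑ p ∈ S, ∑ a : Fin D, h p a * Y p a) ∂τ) / s ^ 2)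
        (𝓝[≠] 0) (𝓝 ((∫ Y, (∑ p ∈ S, ∑ a : Fin D, h p a * Y p a) ^ 2 ∂τ) / 2)))
    (i j : Fin 4) (hij : i < j) (a : Fin D) (L : ℕ) :
    (∫ Y, (Y ((0 : Site 4), ⟨(i, j), hij⟩) a) ^ 2 ∂τ) - 1 / 2 =
      (∫ Y, ((∑ t ∈ Finset.range (L + 1),
          Y ((Pi.single (0 : Fin 4) (t : ℤ) : Site 4), ⟨(i, j), hij⟩) a) / ((L + 1 : ℕ) : ℝ)) ^ 2 ∂τ) -
        (∑ s ∈ Finset.range (L + 1), ∑ t ∈ Finset.range (L + 1),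
          curvatureTwoPoint ((Pi.single (0 : Fin 4) (s : ℤ) : Site 4), ⟨(i, j), hij⟩)
            ((Pi.single (0 : Fin 4) (t : ℤ) : Site 4), ⟨(i, j), hij⟩)) / (((L + 1 : ℕ) : ℝ) ^ 2) := by
  classical
  -- the index set: the line of length `L+1`
  set S : Finset (ZdPlaquette 4) := (Finset.range (L + 1)).image fun t : ℕ =>
    (((Pi.single (0 : Fin 4) (t : ℤ) : Site 4), ⟨(i, j), hij⟩) : ZdPlaquette 4) with hSdef
  have hS : ∀ t ∈ Finset.range (L + 1),
      (((Pi.single (0 : Fin 4) (t : ℤ) : Site 4), ⟨(i, j), hij⟩) : ZdPlaquette 4) ∈ S :=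
    fun t ht => Finset.mem_image_of_mem _ ht
  set p₀ : ZdPlaquette 4 := ((0 : Site 4), ⟨(i, j), hij⟩) with hp₀def
  have hp₀ : p₀ ∈ S := by
    have h0 := hS 0 (Finset.mem_range.2 (Nat.succ_pos L))
    simpa [hp₀def] using h0
  -- the two test cochains
  set δ : ZdPlaquette 4 → Fin D → ℝ := fun p b => if p = p₀ ∧ b = a then (1 : ℝ) else 0 with hδ
  set hL : ZdPlaquette 4 → Fin D → ℝ := fun p b => if b = a then (∑ t ∈ Finset.range (L + 1),
      if p = (((Pi.single (0 : Fin 4) (t : ℤ) : Site 4), ⟨(i, j), hij⟩) : ZdPlaquette 4)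
        then (1 : ℝ) else 0) / ((L + 1 : ℕ) : ℝ) else 0 with hhL
  -- equal plane–colour sums of `s • δ` and `s • hL`
  have hplanes : ∀ (s : ℝ) (i' j' : Fin 4) (hij' : i' < j') (b : Fin D),
      ∑ p ∈ S, (if p.2 = ⟨(i', j'), hij'⟩ then s * δ p b else 0) =
        ∑ p ∈ S, (if p.2 = ⟨(i', j'), hij'⟩ then s * hL p b else 0) := by
    intro s i' j' hij' b
    have e1 : ∀ (g : ZdPlaquette 4 → Fin D → ℝ), (∑ p ∈ S, (if p.2 = ⟨(i', j'), hij'⟩ then s * g p b else 0)) =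
        s * ∑ p ∈ S, (if p.2 = ⟨(i', j'), hij'⟩ then g p b else 0) := by
      intro g
      rw [Finset.mul_sum]
      refine Finset.sum_congr rfl fun p _ => ?_
      split_ifs <;> simp
    rw [e1, e1, hδ, hhL, planeSum_delta S hp₀ a b, planeSum_line i j hij S (L + 1) a b hS]
    simp only [Finset.card_range]
    have hL1 : (((L + 1 : ℕ) : ℝ)) / ((L + 1 : ℕ) : ℝ) = 1 := div_self (by positivity)
    rw [hL1]
  -- F5 for each `s`
  have hEq : ∀ s : ℝ, Real.exp (s ^ 2 * (1 / 2) / 2) * ∫ Y, Real.cos (s * Y p₀ a) ∂τ =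
      Real.exp (s ^ 2 * ((∑ s ∈ Finset.range (L + 1), ∑ t ∈ Finset.range (L + 1),
          curvatureTwoPoint ((Pi.single (0 : Fin 4) (s : ℤ) : Site 4), ⟨(i, j), hij⟩)
            ((Pi.single (0 : Fin 4) (t : ℤ) : Site 4), ⟨(i, j), hij⟩)) / (((L + 1 : ℕ) : ℝ) ^ 2)) / 2) *
        ∫ Y, Real.cos (s * ((∑ t ∈ Finset.range (L + 1),
          Y ((Pi.single (0 : Fin 4) (t : ℤ) : Site 4), ⟨(i, j), hij⟩) a) / ((L + 1 : ℕ) : ℝ))) ∂τ := by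
    intro s
    have h5 := (hF5τ S (fun p b => s * δ p b) (fun p b => s * hL p b) (hplanes s)).1
    simp only [quad_smul, pair_smul] at h5
    rw [hδ, quad_delta S hp₀ a, curvatureTwoPoint_self (by norm_num) p₀] at h5
    simp only [pair_delta S hp₀ a] at h5
    rw [hhL, quad_line i j hij S (L + 1) a hS] at h5
    simp only [pair_line i j hij S (L + 1) a hS] at h5
    convert h5 using 3; norm_num
  -- F6 for the two cochains
  have h6δ := hF6τ S δ
  simp only [hδ, pair_delta S hp₀ a] at h6δ
  have h6L := hF6τ S hL
  simp only [hhL, pair_line i j hij S (L + 1) a hS] at h6L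
  exact defect_eq h6δ h6L hEq

end Main

end Rigidity

/-- Registered anchor of part C: the **line defect identity** (see `Rigidity.line_defect`). -/
theorem stub_rigidityLineDefect :
    ∀ (D : ℕ) (τ : Measure (ZdPlaquette 4 → Fin D → ℝ)),
      (∀ (S : Finset (ZdPlaquette 4)) (h h' : ZdPlaquette 4 → Fin D → ℝ),
        (∀ (i j : Fin 4) (hij : i < j) (a : Fin D),
          ∑ p ∈ S, (if p.2 = ⟨(i, j), hij⟩ then h p a else 0) =
            ∑ p ∈ S, (if p.2 = ⟨(i, j), hij⟩ then h' p a else 0)) →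
        (Real.exp ((∑ p ∈ S, ∑ q ∈ S, ∑ a : Fin D, h p a * h q a * curvatureTwoPoint p q) / 2) *
            ∫ Y, Real.cos (∑ p ∈ S, ∑ a : Fin D, h p a * Y p a) ∂τ =
          Real.exp ((∑ p ∈ S, ∑ q ∈ S, ∑ a : Fin D, h' p a * h' q a * curvatureTwoPoint p q) / 2) *
            ∫ Y, Real.cos (∑ p ∈ S, ∑ a : Fin D, h' p a * Y p a) ∂τ) ∧
        (Real.exp ((∑ p ∈ S, ∑ q ∈ S, ∑ a : Fin D, h p a * h q a * curvatureTwoPoint p q) / 2) *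
            ∫ Y, Real.sin (∑ p ∈ S, ∑ a : Fin D, h p a * Y p a) ∂τ =
          Real.exp ((∑ p ∈ S, ∑ q ∈ S, ∑ a : Fin D, h' p a * h' q a * curvatureTwoPoint p q) / 2) *
            ∫ Y, Real.sin (∑ p ∈ S, ∑ a : Fin D, h' p a * Y p a) ∂τ)) →
      (∀ (S : Finset (ZdPlaquette 4)) (h : ZdPlaquette 4 → Fin D → ℝ),
        Tendsto (fun s : ℝ => (1 - ∫ Y, Real.cos (s * ∑ p ∈ S, ∑ a : Fin D, h p a * Y p a) ∂τ) / s ^ 2)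
          (𝓝[≠] 0) (𝓝 ((∫ Y, (∑ p ∈ S, ∑ a : Fin D, h p a * Y p a) ^ 2 ∂τ) / 2))) →
      ∀ (i j : Fin 4) (hij : i < j) (a : Fin D) (L : ℕ),
        (∫ Y, (Y ((0 : Site 4), ⟨(i, j), hij⟩) a) ^ 2 ∂τ) - 1 / 2 =
          (∫ Y, ((∑ t ∈ Finset.range (L + 1),
              Y ((Pi.single (0 : Fin 4) (t : ℤ) : Site 4), ⟨(i, j), hij⟩) a) / ((L + 1 : ℕ) : ℝ)) ^ 2 ∂τ) -
            (∑ s ∈ Finset.range (L + 1), ∑ t ∈ Finset.range (L + 1),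
              curvatureTwoPoint ((Pi.single (0 : Fin 4) (s : ℤ) : Site 4), ⟨(i, j), hij⟩)
                ((Pi.single (0 : Fin 4) (t : ℤ) : Site 4), ⟨(i, j), hij⟩)) / (((L + 1 : ℕ) : ℝ) ^ 2) :=
  fun _ _ hF5τ hF6τ i j hij a L => Rigidity.line_defect hF5τ hF6τ i j hij a L

end Summit.QuantumFields.YangMills.Theorems.EquipartitionPinsProbe

end
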